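import Literature.MathematicalPhysics.QuantumFieldTheory.Balaban1983to89.B9Eq326LocalInvTowerSliceGradientRowDiagonal
import Literature.MathematicalPhysics.QuantumFieldTheory.Balaban1983to89.B9Eq326LocalPartTowerSupDecayDiagonalClosed

/-!
# `Balaban1983to89.B9Eq326LocalInvTowerSliceGradientRowClosed` — T. Bałaban, *Propagators for lattice gauge theories in a background field*, Commun. Math.
# Phys. **99** (1985) 389–434 [Balaban1985BackgroundPropagators] Thm 3.1 (3.42) p. 397 SECOND ENTRY with Thm 3.3 p. 399 (*«with G′(U) replaced by G(U) and λ
# replaced by a function defined at bonds»*), (3.3) p. 391, (3.26) p. 395, (3.35)–(3.37) p. 396, (3.49) p. 399, Thm 3.13 p. 426; [Balaban1985Variational] (115) p. 294,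
# (117) p. 295: **THE COVARIANT (SLICE) GRADIENT ROW OF THE TOWER LOCAL PART `A₀,k⁻¹`, FULLY CLOSED ON PRINT's DIAGONAL — `∃ α₂ B δ` BEFORE
# `∀ n η c₀ c₁ m U`: for a source `f` supported over ONE unit block `v` with `‖f(b)‖ ≤ F`, every component `μ` and every fine bond `b₀`,
# `‖(D_U (A₀,k⁻¹f)_μ)(b₀)‖ ≤ B·e^{−δ·d_m(Π(b₀₊), v)}·F` AND `‖(∇_U A₀,k⁻¹f)(b₀, μ)‖ ≤ B·e^{−δ·d_m(Π(b₀₊), v)}·F`, at EVERY height, every background of the MODEL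
# letters in ONE window `α ≤ α₂` — the binder block of ne9-leaf-03's (ECL) `exists_sup_decay_localInvK_diagonal_closed` plus the bond-gradient datum
# `hUgrad : ‖U(x,μ) − U(x−e_μ,μ)‖ ≤ αη²` (print's second size of (3.35))** — the `∃`-first form of this lineage's (VGTD)
# `B9Eq326LocalInvTowerSliceGradientRowDiagonal` with every letter inhabited: the decayed value row `C_u` by (ECL), the plaquette letters by ne9-leaf-03's
# `B9Eq3126H1RowLettersDiagonalClosed.exists_H1_row_letters_diagonal_closed`, (T) by unitarity (`norm_adTransportW_eq`), the comparison mass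
# `m_c := max(2, 4d(cosh δ − 1))` and the window `α₂ := min(α₁, α₀, √m_c∕(D₀+1))` chosen here; the slice twin of this lineage's (GRC)
# `B9Eq342GreenPrimeTowerGradientRowClosed.exists_gradRow_GpOfUk` — the letter the `∇_UG₁,k` END (Woodbury: `∇_UG₁,k = ∇_UA₀,k⁻¹ + ∇_UA₀,k⁻¹(C*z)`, the
# GRADIENT member of (117)) consumes for its outer factor; NE9 owner INTENT-4 gen 96

statement-level skeleton of published theorems with citation tags; proofs where landed; nothing here is a claim about the Yang–Mills mass gap

CITATION HEADER (lean-in-tree rule).  Audit cell `pub-balaban`, sub-cell `t4`, BINDER row NE9; filed by the NE9 OWNER lineage `b2b-balaban-t4-ne9-p1` (gen 96).  Imports this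
lineage's (VGTD) and ne9-leaf-03's (ECL) `B9Eq326LocalPartTowerSupDecayDiagonalClosed` (through it `B9Eq3126H1RowLettersDiagonalClosed`, `B9Eq342GreenPrimeSupBound`).
SOURCE READ first-hand in the held text layer [Balaban1985BackgroundPropagators] (`paper:balaban1985-cmp99-background-propagators`): p. 396 (3.35)–(3.37); p. 397
Thm 3.1 and (3.42); p. 399 Thm 3.3, (3.49); p. 426 Thm 3.13; [Balaban1985Variational] p. 294 (115), p. 295 (117).  Print's random-walk proof is NOT reproduced;
[folklore] quantifier bookkeeping BY NAME; nothing printed is a hypothesis except the model letters.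

WHAT IS PROVED (sorry-free; proof lane — no `def`; [folklore]).  **`exists_sliceGradRow_localInvK_diagonal_closed`** — `∃ α₂ B δ, 0 < α₂ ∧ 0 ≤ B ∧ 0 < δ ∧ ∀ ⟨(ECL)'s
block + hUgrad⟩ μ b₀, ‖(D_U(A₀⁻¹f)_μ)(b₀)‖ ≤ B·e^{−δd}·F ∧ ‖(∇_U(A₀⁻¹f))(b₀, μ)‖ ≤ B·e^{−δd}·F`: (ECL) gives `(α₁, B₁, δ₁)`; (HL) gives `α₀` and the plaquette
letters at `αη²`; `δ := δ₁` (the value row's rate is the gradient row's rate, `κ ≤ κ₀ := δ₁`); every model letter weakened from `α` to `α₂` so that (VGTD) is read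
at ONE size (no monotonicity lemma); the `covGrad` member by (VGT-a) `norm_covGrad_apply_le_of_slice`.
HONEST SCOPE.  Bookkeeping only; `B` symbolic and crude (it carries (ECL)'s `B₁` and the diagonal bracket of (VGTD) at `α₂`); the MODEL letters (`U ∈ U1`, `star U = U⁻¹`,
`‖U − 1‖ ≤ αη`, `‖U(∂p) − 1‖ ≤ αη²`, the bond-gradient datum `αη²` — NOT derivable from the others, cf. the CONSUMER NOTE of (GT) —, level averages `‖Ū^j − 1‖ ≤ ε_j ≤
αϱ^j` in `U1`, the (1.18)-regularity letters `α_j ≤ 1∕64`, `Σα_j ≤ A_Q`, the weight ratio `|η|^d∕c₀ ≤ ρ_w`) and the positivity witness `hpos₀` (any; inhabited on the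
model by (HL)'s coercivity (γ) through (LPC)) stay DISPLAYED; nothing of [B9] Thm 3.1∕3.3∕3.11∕3.13 is asserted, valued or discharged.  NOT summit progress (cell
pub-balaban: NE9 NOT PRINTED ∕ NOT PROVED; «NE9 ⇐ the named binders»; row WALLED ON A MODEL (O-NE9-1; #5 UNRULED); spine PROVED 0∕9; rung (B)+1 on a finite T⁴ — NOT infinite
volume, NOT mass gap, NOT BetaPertH, NOT Clay).  HONEST DEPENDENCY (cell line): continuum YM on T⁴ ⇐ BetaPertH ∧ nine spine estimates (0/9 proved); BetaPertH ⇐ (D1) ∧ (D4) ∧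
CAP+tail; G-an2-4 gates asym, D1 and NE2/3/4.  NEW file; nothing modified.  Net new unproved facts: 0.
-/

noncomputable section

set_option autoImplicit false

open scoped BigOperators InnerProductSpace ComplexConjugate

namespace Literature.MathematicalPhysics.QuantumFieldTheory.Balaban1983to89.B9Eq326LocalInvTowerSliceGradientRowClosed

open B4Sect5Torus (TSite tdist)
open B9SectCLatticeCarrier (Bond DirPair bpos btgt shift unshift)
open B4TorusKernel.MultiPeriod (circAbs)
open B9Eq311L2Pairing (WL2)
open B9Eq33CovDerivVector (covGrad)
open B11Eq103H1Complex (SiteL2K BondL2K covDivL2K covDerivL2K greenK)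
open B9Eq310HessianOperator (adTransportW hessOp)
open B9Eq310DeltaPrime (plaqHolU reHol imHol)
open B7Prop1Explicit (U1 Wcx boxVec)
open B9Eq319QprimeTorus (fineP blockCoord)
open B9Eq315QTorus (perCfg cornerSite)
open B9Eq315QTower (towerP UlevOf)
open B9Eq316TowerFlatIsOneStep (towerP_eq_fineP_pow siteCast)
open B9Eq326OperatorTower (QkW)
open B9Eq342GreenPrimeSupBound (norm_adTransportW_eq norm_adTransportW_inv_eq)
open B9Eq326LocalPartTowerSliceGradientRow (norm_covGrad_apply_le_of_slice)
open B9Eq326LocalInvTowerSliceGradientRowDiagonal (norm_covDerivL2K_slice_localInvK_le_bigBlockLetter_diagonal)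
open B9Eq326LocalPartTowerSupDecayDiagonalClosed (exists_sup_decay_localInvK_diagonal_closed)
open B9Eq3126H1RowLettersDiagonalClosed (exists_H1_row_letters_diagonal_closed)

section Closed

variable {d : ℕ} (hd : 1 ≤ d) (L : ℕ) [NeZero L] (hL : 1 ≤ L) (hL3 : 3 ≤ L)
  {𝔸 : Type*} [NormedRing 𝔸] [NormedAlgebra ℂ 𝔸] [CompleteSpace 𝔸] [NormOneClass 𝔸] [StarRing 𝔸] [NormedStarGroup 𝔸] [StarModule ℂ 𝔸]
  {W : Type*} [NormedAddCommGroup W] [InnerProductSpace ℂ W] [FiniteDimensional ℂ W] (φ : W ≃ₗ[ℂ] 𝔸)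
  {Mφ Mφ' : ℝ} (hMφ : 0 ≤ Mφ) (hMφ' : 0 ≤ Mφ') (hφ : ∀ w, ‖φ w‖ ≤ Mφ * ‖w‖) (hφ' : ∀ X, ‖φ.symm X‖ ≤ Mφ' * ‖X‖) (hstar : ∀ X : 𝔸, ‖star X‖ ≤ ‖X‖)
  {a : ℝ} (ha : 0 < a) {a' : ℝ} (ha' : 0 < a') {ϱ : ℝ} (hϱ0 : 0 ≤ ϱ) (hϱ1 : ϱ < 1)
  (τ : 𝔸 →ₗ[ℂ] ℂ) {Cτ : ℝ} (hτ : ∀ X, ‖τ X‖ ≤ Cτ * ‖X‖) (hCτ : 0 ≤ Cτ) {Mτ : ℝ} (hτm : ∀ X Y : 𝔸, ‖τ (X * Y)‖ ≤ Mτ * ‖X‖ * ‖Y‖) (hMτ : 0 ≤ Mτ)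
  {ρw : ℝ} (hρw : 0 ≤ ρw)
  (hτ₁ : ∀ X : 𝔸, τ (star X) = conj (τ X)) (hτ₂ : ∀ X Y : 𝔸, τ (X * Y) = τ (Y * X)) (hφτ : ∀ X Y : 𝔸, ⟪φ.symm X, φ.symm Y⟫_ℂ = τ (star X * Y))
  (AQ : ℝ)

set_option maxHeartbeats 400000 in -- ≈ 45 binders + the displayed closed constant: the final defeq assembly exceeds the default budget (as (ECL), (GTD))
include hd hL hL3 hMφ hMφ' hφ hφ' hstar ha ha' hϱ0 hϱ1 hτ hCτ hτm hMτ hρw hτ₁ hτ₂ hφτ in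
/-- **THE SLICE-GRADIENT ROW OF THE TOWER LOCAL PART, FULLY CLOSED ON THE DIAGONAL — `∃ α₂ B δ` BEFORE `∀ n η c₀ c₁ m U`.**  For every height `n`, spacing `η`
(`ηL^{n+1} = 1`), weights on the diagonal with `|η|^d∕c₀ ≤ ρ_w`, lattice `m` (`1 ≤ m_i`), background `U` of the MODEL letters in the window `α ≤ α₂` INCLUDING the
bond-gradient datum `‖U(x,μ) − U(x−e_μ,μ)‖ ≤ αη²` (and the loop window `Σ_{j<n+1}α_j ≤ A_Q`), every positivity witness `hpos₀` of
`A₀ = Δ(U) + D_UD*_U + Q_k(U)†(a•Q_k(U))`, every big-block bond family `P`, every source `f` supported over the unit block `v` with `‖f(b)‖ ≤ F`, every component `μ`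
and every fine bond `b₀`: `‖(D_U(A₀⁻¹f)_μ)(b₀)‖ ≤ B·e^{−δ·d_m(Π(b₀₊), v)}·F` and `‖(∇_U(A₀⁻¹f))(b₀, μ)‖ ≤ B·e^{−δ·d_m(Π(b₀₊), v)}·F` — (VGTD) with every letter inhabited.
[cite: Balaban1985BackgroundPropagators, Thm 3.1 (3.42) p.397, Thm 3.3 p.399, (3.3) p.391, (3.26) p.395, (3.35)–(3.37) p.396, (3.49) p.399, Thm 3.13 p.426;
Balaban1985Variational, (115) p.294, (117) p.295] -/
theorem exists_sliceGradRow_localInvK_diagonal_closed :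
    ∃ α₂ B δ : ℝ, 0 < α₂ ∧ 0 ≤ B ∧ 0 < δ ∧
      ∀ (n : ℕ) (η : ℝ) (_hηL : η * (L : ℝ) ^ (n + 1) = 1) (c₀ c₁ : ℝ) [Fact (0 < c₀)] [Fact (0 < c₁)]
        (_hw : c₀ * ((L : ℝ) ^ (n + 1)) ^ d = c₁) (_hρ : |η| ^ d / c₀ ≤ ρw) (m : Fin d → ℕ) [∀ i, NeZero (m i)] (_hm : ∀ i, 1 ≤ m i)
        (U : Bond d (towerP L m (n + 1)) → 𝔸ˣ) (αU : ℕ → ℝ) (_hα0 : ∀ j, 0 ≤ αU j) (hα1 : ∀ j, αU j ≤ 1 / 64)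
        (hU1 : ∀ (j : ℕ) (x : B7Prop1Explicit.Site d) (k : Fin d), perCfg (towerP L m (j + 1)) (UlevOf L m (n + 1) U j) x k ∈ U1 𝔸)
        (hreg : ∀ (j : ℕ) (y : TSite d (towerP L m j)) (k : Fin d) (ρ' : Fin d → Fin L),
          ‖((Wcx L (perCfg (towerP L m (j + 1)) (UlevOf L m (n + 1) U j)) (cornerSite L y) k (boxVec L ρ') : 𝔸ˣ) : 𝔸) - 1‖ ≤ αU j)
        (εU : ℕ → ℝ) (_hεU : ∀ j, 0 ≤ εU j) (_hUε : ∀ (j : ℕ) (b : Bond d (towerP L m (j + 1))), ‖(UlevOf L m (n + 1) U j b : 𝔸) - 1‖ ≤ εU j)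
        (_hLb : ∀ (j : ℕ) (b : Bond d (towerP L m (j + 1))), UlevOf L m (n + 1) U j b ∈ U1 𝔸)
        (α : ℝ) (_hα : 0 ≤ α) (_hαle : α ≤ α₂)
        (_hUst : ∀ b, star (U b : 𝔸) = (((U b)⁻¹ : 𝔸ˣ) : 𝔸)) (_hUb : ∀ b, U b ∈ U1 𝔸) (_hUη : ∀ b, ‖(U b : 𝔸) - 1‖ ≤ α * η)
        (_hpl : ∀ p : B9SectCLatticeCarrier.Plaq d (towerP L m (n + 1)), ‖(plaqHolU U p : 𝔸) - 1‖ ≤ α * η ^ 2)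
        (_hUgrad : ∀ (x : TSite d (towerP L m (n + 1))) (μ : Fin d), ‖(U (x, μ) : 𝔸) - (U (unshift μ x, μ) : 𝔸)‖ ≤ α * η ^ 2)
        (_hεg : ∀ j < n + 1, εU j ≤ α * ϱ ^ j) (_hAQ : ∑ j ∈ Finset.range (n + 1), αU j ≤ AQ)
        (A₀ : BondL2K ℂ d (towerP L m (n + 1)) c₀ W →ₗ[ℂ] BondL2K ℂ d (towerP L m (n + 1)) c₀ W)
        (_hA₀ : A₀ = hessOp φ η U τ + covDerivL2K ℂ c₀ ((η : ℂ))⁻¹ (adTransportW φ U) ∘ₗ covDivL2K ℂ c₀ ((η : ℂ))⁻¹ (adTransportW φ fun b => (U b)⁻¹) +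
          LinearMap.adjoint (QkW L m n φ U hL αU hα1 hU1 hreg (c₀ := c₀) (c₁ := c₁)) ∘ₗ ((a : ℂ) • QkW L m n φ U hL αU hα1 hU1 hreg (c₀ := c₀) (c₁ := c₁)))
        (hpos₀ : ∀ x : BondL2K ℂ d (towerP L m (n + 1)) c₀ W, x ≠ 0 → 0 < RCLike.re ⟪x, A₀ x⟫_ℂ)
        (PB : TSite d m → BondL2K ℂ d (towerP L m (n + 1)) c₀ W →L[ℂ] BondL2K ℂ d (towerP L m (n + 1)) c₀ W)
        (_hPB : ∀ (y : TSite d m) (f : BondL2K ℂ d (towerP L m (n + 1)) c₀ W) (b : Bond d (towerP L m (n + 1))),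
          WL2.equiv ℂ (fun _ : Bond d (towerP L m (n + 1)) => c₀) W (PB y f) b =
            if blockCoord (L ^ (n + 1)) m (siteCast (towerP_eq_fineP_pow L m (n + 1)) (bpos b)) = y then
              WL2.equiv ℂ (fun _ : Bond d (towerP L m (n + 1)) => c₀) W f b else 0)
        (v : TSite d m) (f : BondL2K ℂ d (towerP L m (n + 1)) c₀ W)
        (_hfv : ∀ b, blockCoord (L ^ (n + 1)) m (siteCast (towerP_eq_fineP_pow L m (n + 1)) b.1) ≠ v →
          WL2.equiv ℂ (fun _ : Bond d (towerP L m (n + 1)) => c₀) W f b = 0)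
        (F : ℝ) (_hF0 : 0 ≤ F) (_hfF : ∀ b, ‖WL2.equiv ℂ (fun _ : Bond d (towerP L m (n + 1)) => c₀) W f b‖ ≤ F)
        (μ : Fin d) (b₀ : Bond d (towerP L m (n + 1))),
        ‖WL2.equiv ℂ (fun _ : Bond d (towerP L m (n + 1)) => c₀) W (covDerivL2K ℂ c₀ ((η : ℂ))⁻¹ (adTransportW φ U) ((WL2.equiv ℂ (fun _ : TSite d (towerP L m (n + 1)) => c₀) W).symm fun y => WL2.equiv ℂ (fun _ : Bond d (towerP L m (n + 1)) => c₀) W (greenK A₀ hpos₀ f) (y, μ))) b₀‖ ≤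
            B * Real.exp (-(δ * tdist m (blockCoord (L ^ (n + 1)) m (siteCast (towerP_eq_fineP_pow L m (n + 1)) (btgt b₀))) v)) * F ∧
          ‖covGrad ((η : ℂ))⁻¹ (adTransportW φ U) (WL2.equiv ℂ (fun _ : Bond d (towerP L m (n + 1)) => c₀) W (greenK A₀ hpos₀ f)) (b₀, μ)‖ ≤
            B * Real.exp (-(δ * tdist m (blockCoord (L ^ (n + 1)) m (siteCast (towerP_eq_fineP_pow L m (n + 1)) (btgt b₀))) v)) * F := by
  classical
  have hL2 : 2 ≤ L := le_trans (by norm_num) hL3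
  have hd1 : (0 : ℝ) ≤ (d : ℝ) - 1 := sub_nonneg.mpr (by exact_mod_cast hd)
  -- the two `∃`-first suppliers: (ECL) the decayed value row, (HL) the window of the plaquette letters
  obtain ⟨α₁, B₁, δ₁, hα₁, hB₁, hδ₁, HV⟩ := exists_sup_decay_localInvK_diagonal_closed hd L hL hL3 φ hMφ hMφ' hφ hφ' hstar ha ha' hϱ0 hϱ1 τ hτ hCτ hτm
    hMτ hρw hτ₁ hτ₂ hφτ AQ
  obtain ⟨α₀l, γ, μ₁, γ', κ₁', M', hα₀l, -, -, -, -, -, -, -, -, HL⟩ :=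
    exists_H1_row_letters_diagonal_closed hd L hL hL3 φ hMφ hMφ' hφ hφ' ha ha' hϱ0 hϱ1 τ hτ hCτ hρw hτ₁ hτ₂ hφτ hMτ
  -- the closed letters: comparison mass, smallness threshold, window, bound
  set mc : ℝ := max 2 (4 * (d : ℝ) * (Real.cosh δ₁ - 1)) with hmc_def
  have hmc2 : 2 ≤ mc := le_max_left _ _
  have hwin4 : 4 * (d : ℝ) * (Real.cosh δ₁ - 1) ≤ mc := le_max_right _ _
  have hmc : 0 < mc := by linarith
  have hsinh : 0 ≤ Real.sinh δ₁ := Real.sinh_nonneg_iff.2 hδ₁.le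
  set D₀ : ℝ := 2 * (2 * Mφ * Mφ') * (Real.exp δ₁ + 1) * (d : ℝ) * ((1 + 2 / 1) * Real.sqrt 2 + 4 * Real.sinh δ₁) with hD₀_def
  have hD₀ : 0 ≤ D₀ := by positivity
  set α₂ : ℝ := min (min α₁ α₀l) (Real.sqrt mc / (D₀ + 1)) with hα₂_def
  have hα₂ : 0 < α₂ := lt_min (lt_min hα₁ hα₀l) (by positivity)
  have hα₂1 : α₂ ≤ α₁ := (min_le_left _ _).trans (min_le_left _ _)
  have hα₂l : α₂ ≤ α₀l := (min_le_left _ _).trans (min_le_right _ _)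
  have hα₂s : α₂ ≤ Real.sqrt mc / (D₀ + 1) := min_le_right _ _
  set C₁ : ℝ := ((1 + 2 / 1) * Real.sqrt 2 + 4 * Real.sinh δ₁) / Real.sqrt mc with hC₁_def
  have hC₁ : 0 ≤ C₁ := by positivity
  set cPf : ℝ := (768 * Fintype.card (DirPair d) * Mτ * Mφ ^ 2 * ρw * α₂ * Real.exp δ₁ ^ 2 +
        |a| * (Mφ' * Mφ * Real.exp (100 * d * (d + 1) * (L : ℝ) ^ d * AQ) * ((2 * d : ℕ) : ℝ) *
          ((Mφ' * Mφ * Real.exp (Real.sqrt ((L : ℝ) ^ d) * (Real.sqrt (2 * d) * (102 * (d + 1) ^ 2 * L)) * (α₂ / (1 - ϱ)))) *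
            (2 * ((Fintype.card (Option (Fin d × Bool)) : ℝ) * Real.sqrt d)))) * Real.exp (2 * (d : ℝ) * δ₁) +
        (d - 1 : ℝ) * (2 * Mφ * Mφ' * (2 * α₂)) * Real.exp δ₁ ^ 2) with hcPf_def
  have hcPf : 0 ≤ cPf := by
    have h3 : 0 ≤ (d - 1 : ℝ) * (2 * Mφ * Mφ' * (2 * α₂)) * Real.exp δ₁ ^ 2 := mul_nonneg (mul_nonneg hd1 (by positivity)) (by positivity)
    exact add_nonneg (add_nonneg (by positivity) (by positivity)) h3
  set B : ℝ := 2 * Real.exp δ₁ * (2 * C₁ * (1 + ((cPf + mc) +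
      (d : ℝ) * (2 * Mφ * Mφ' * α₂ + (2 * Mφ * Mφ' * α₂) * (2 * Mφ * Mφ' * α₂)) + Mφ * Mφ' * α₂ * mc / δ₁) * B₁)) with hB_def
  have hB : 0 ≤ B := by
    have : 0 ≤ (cPf + mc) + (d : ℝ) * (2 * Mφ * Mφ' * α₂ + (2 * Mφ * Mφ' * α₂) * (2 * Mφ * Mφ' * α₂)) + Mφ * Mφ' * α₂ * mc / δ₁ := by positivity
    positivity
  refine ⟨α₂, B, δ₁, hα₂, hB, hδ₁, ?_⟩
  intro n η hηL c₀ c₁ _ _ hw hρ m _ hm U αU hα0 hα1 hU1 hreg εU hεU hUε hLb α hα hαle hUst hUb hUη hpl hUgrad hεg hAQ A₀ hA₀ hpos₀ PB hPB v f hfv F hF0 hfF μ b₀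
  -- `η > 0`
  have hL0 : (0 : ℝ) < L := by exact_mod_cast (lt_of_lt_of_le (by norm_num) hL3 : 0 < L)
  have htpos : (0 : ℝ) < (L : ℝ) ^ (n + 1) := pow_pos hL0 _
  have hη : 0 < η := by
    by_contra h
    have : η * (L : ℝ) ^ (n + 1) ≤ 0 := mul_nonpos_of_nonpos_of_nonneg (not_lt.mp h) htpos.le
    linarith only [this, hηL]
  -- the smallness window at `α₂`
  have hsmall : 2 * ((2 * Mφ * Mφ' * α₂) * (Real.exp δ₁ + 1) * (d : ℝ) * ((1 + 2 / 1) * Real.sqrt 2 + 4 * Real.sinh δ₁)) ≤ Real.sqrt mc := by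
    have e : 2 * ((2 * Mφ * Mφ' * α₂) * (Real.exp δ₁ + 1) * (d : ℝ) * ((1 + 2 / 1) * Real.sqrt 2 + 4 * Real.sinh δ₁)) = D₀ * α₂ := by
      rw [hD₀_def]; ring
    rw [e]
    have hs : 0 ≤ Real.sqrt mc := Real.sqrt_nonneg _
    have h1 : D₀ * α₂ ≤ D₀ * (Real.sqrt mc / (D₀ + 1)) := mul_le_mul_of_nonneg_left hα₂s hD₀
    have h2 : D₀ * (Real.sqrt mc / (D₀ + 1)) ≤ Real.sqrt mc := by
      rw [mul_div_assoc', div_le_iff₀ (by positivity)]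
      calc D₀ * Real.sqrt mc ≤ (D₀ + 1) * Real.sqrt mc := mul_le_mul_of_nonneg_right (le_add_of_nonneg_right zero_le_one) hs
        _ = Real.sqrt mc * (D₀ + 1) := mul_comm _ _
    exact h1.trans h2
  -- the model letters weakened to the window's edge `α₂`
  have hη2 : 0 ≤ η ^ 2 := by positivity
  have hUη₂ : ∀ b, ‖(U b : 𝔸) - 1‖ ≤ α₂ * η := fun b => (hUη b).trans (mul_le_mul_of_nonneg_right hαle hη.le)
  have hUgrad₂ : ∀ (x : TSite d (towerP L m (n + 1))) (μ : Fin d), ‖(U (x, μ) : 𝔸) - (U (unshift μ x, μ) : 𝔸)‖ ≤ α₂ * η ^ 2 :=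
    fun x μ => (hUgrad x μ).trans (mul_le_mul_of_nonneg_right hαle hη2)
  have hεg₂ : ∀ j < n + 1, εU j ≤ α₂ * ϱ ^ j := fun j hj => (hεg j hj).trans (mul_le_mul_of_nonneg_right hαle (pow_nonneg hϱ0 j))
  obtain ⟨-, -, -, -, -, -, hRe, hIm, -⟩ := HL n η hηL c₀ c₁ hw hρ m U αU hα1 hU1 hreg εU hεU hUε hLb hα (hαle.trans hα₂l) hUst hUb hUη hpl hεg
  have hRe₂ : ∀ p : B9SectCLatticeCarrier.Plaq d (towerP L m (n + 1)), ‖reHol U p - 1‖ ≤ α₂ * η ^ 2 :=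
    fun p => (hRe p).trans (mul_le_mul_of_nonneg_right hαle hη2)
  have hIm₂ : ∀ p : B9SectCLatticeCarrier.Plaq d (towerP L m (n + 1)), ‖imHol U p‖ ≤ α₂ * η ^ 2 :=
    fun p => (hIm p).trans (mul_le_mul_of_nonneg_right hαle hη2)
  -- (T) from unitarity
  have hR : ∀ (b : Bond d (towerP L m (n + 1))) (w : W), ‖adTransportW φ U b w‖ ≤ ‖w‖ :=
    fun b w => le_of_eq (norm_adTransportW_eq φ U τ hτ₂ hUst hφτ b w)
  have hS : ∀ (b : Bond d (towerP L m (n + 1))) (w : W), ‖adTransportW φ (fun b => (U b)⁻¹) b w‖ ≤ ‖w‖ :=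
    fun b w => le_of_eq (norm_adTransportW_inv_eq φ U τ hτ₂ hUst hφτ b w)
  -- the decayed value row at this background (the `hudec` letter), rate `δ₁`
  have hudec : ∀ b : Bond d (towerP L m (n + 1)), ‖WL2.equiv ℂ (fun _ : Bond d (towerP L m (n + 1)) => c₀) W (greenK A₀ hpos₀ f) b‖ ≤
      B₁ * F * Real.exp (-(δ₁ * tdist m (blockCoord (L ^ (n + 1)) m (siteCast (towerP_eq_fineP_pow L m (n + 1)) b.1)) v)) := fun b => by
    have h := HV n η hηL c₀ c₁ hw hρ m hm U αU hα0 hα1 hU1 hreg εU hεU hUε hLb α hα (hαle.trans hα₂1) hUst hUb hUη hpl hεg hAQ A₀ hA₀ hpos₀ PB hPB v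
      f hfv F hF0 hfF b
    calc _ ≤ B₁ * Real.exp (-(δ₁ * tdist m (blockCoord (L ^ (n + 1)) m (siteCast (towerP_eq_fineP_pow L m (n + 1)) b.1)) v)) * F := h
      _ = _ := mul_right_comm _ _ _
  -- (VGTD) at `θ := δ₁η`, every size at `α₂`
  have h := norm_covDerivL2K_slice_localInvK_le_bigBlockLetter_diagonal L m n φ U hL αU hα0 hα1 hU1 hreg hMφ hφ hMφ' hφ' hstar εU hεU hUε hϱ0 hϱ1
    hα₂.le hεg₂ τ hτm hMτ hUb hα₂.le hα₂.le hUη₂ hUgrad₂ hRe₂ hIm₂ hPB hδ₁ hmc2 hd hL2 hηL hw hρ hR hS a A₀ hA₀ hpos₀ hAQ hwin4 hsmall v f hF0 hB₁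
    hδ₁.le le_rfl hfv hfF hudec μ b₀
  have h1 : ‖WL2.equiv ℂ (fun _ : Bond d (towerP L m (n + 1)) => c₀) W (covDerivL2K ℂ c₀ ((η : ℂ))⁻¹ (adTransportW φ U) ((WL2.equiv ℂ (fun _ : TSite d (towerP L m (n + 1)) => c₀) W).symm fun y => WL2.equiv ℂ (fun _ : Bond d (towerP L m (n + 1)) => c₀) W (greenK A₀ hpos₀ f) (y, μ))) b₀‖ ≤
      B * Real.exp (-(δ₁ * tdist m (blockCoord (L ^ (n + 1)) m (siteCast (towerP_eq_fineP_pow L m (n + 1)) (btgt b₀))) v)) * F := by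
    rw [hB_def, hC₁_def, hcPf_def]
    exact h.trans (le_of_eq (by ring))
  exact ⟨h1, norm_covGrad_apply_le_of_slice _ _ _ b₀ μ h1⟩

end Closed

end Literature.MathematicalPhysics.QuantumFieldTheory.Balaban1983to89.B9Eq326LocalInvTowerSliceGradientRowClosed

end
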